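import Literature.MathematicalPhysics.QuantumFieldTheory.Balaban1983to89.B9LettersZCFieldsAtPins
import Literature.MathematicalPhysics.QuantumFieldTheory.Balaban1983to89.B9Eq3136HstarJAtPinsLetterFamily

/-!
# `Balaban1983to89.B9Eq3129H1TransposeCoords` — [B9] (3.129) `H₁ = G₁Q\*(QG₁Q\*)⁻¹` read BACKWARDS: the COUNTING-TRANSPOSE of the coordinate model of
# def-Y's `H₁(U)` is the explicit composite `C₁ ∘ Q ∘ G₁` (`C₁ = (QG₁Q\*)⁻¹`; all three letters trace-symmetric at gauge-group-valued `U` and a symmetric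
# residual `Δ⁽²⁾(U)`), its [4]-(2.51) majorant from the two letters' majorants — the `H₁` twin of seat n06-w8's `B9Eq3126HTransposeCoords` (F9) and
# `…N06HTransposeAtPinsPhysR` (F10-R) — and the 𝒥-row input (b†) of the (3.24) doors from Thm 3.12's `G₁` sup letter and the weighted (3.132) letter

T. Bałaban, *Propagators for lattice gauge theories in a background field*, Commun. Math. Phys. **99** (1985) 389–434 [`Balaban1985BackgroundPropagators`,
"B9"]; [4] = T. Bałaban, *Propagators and renormalization transformations for lattice gauge theories. II*, Commun. Math. Phys. **96** (1984) 223–250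
[`Balaban1984PropagatorsII`].  statement-level companion of published sources with citation tags; every declaration here is a theorem; nothing here is
a claim about the Yang–Mills mass gap.

THE PRINT.  p. 421, (3.128)–(3.129): `G₁ = (Δ_π − Δ⁽²⁾_π + DRD\* + Q\*aQ)⁻¹`, `H₁ = G₁Q\*(QG₁Q\*)⁻¹`; p. 422 (3.132): the claim for `(QGQ\*)⁻¹` AND `(QG₁Q\*)⁻¹`; Thm 3.12
p. 423: *«Theorems 3.3, 3.10, 3.11 hold for the propagators G, G₁ … and the inequality (3.133) … hold[s] for the operators H, H₁»*; p. 392–393: `Q\*` is the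
adjoint of `Q`; Thm 3.11 p. 416 («symmetric»).  Hence `H₁\* = (QG₁Q\*)⁻¹QG₁` — the transpose of `H₁` is a composite of the same letters, exactly as for `H` (3.126).

WHY THIS FILE (cell `pub-ymgap`, seat `dag-n08-d` gen 42, INTENT-105).  The (3.24) doors of node N08 read PRINT's `H₁(U)` fed `G′_phys` in their 𝒥-row input
(b†); `B9Eq3136HstarJAtPinsLetterFamily` §4 (p711184) supplies (b†) from the WEIGHTED TRANSPOSE SCHEMA `hH1T` of the model `HcoK … (H1Y … (GpPhysY …) (𝔯 x).Δ2) U`.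
Seat n06-w8 inhabited the `H` analogue of that schema (F9 `B9Eq3126HTransposeCoords`: `isTransposePair_HcoK_HDY`, `hasMajorantHom_CQG_of_letters`; F10-R
`…N06HTransposeAtPinsPhysR.hHT_of_GD_C_lettersR`) from Thm 3.12's `G_D` sup letter and the weighted (3.132) letter for `C`.  THIS FILE is the `H₁` twin:
def-Y's dictionary already has every ingredient (`OpsYSectDCoords.C1coK ∕ HcoK_H1Y_eq`, `OpsYSectDESymm.QGQinvOfY_isSymmTr ∕ G1Y_isSymmTr_parSymY`,
`OpsYRecordV4P.G1Y_GpPhysY_isSymmTr_parSymY`), and F9 §2's majorant theorem is generic in the two letters.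
* §1 (the self-transpose of the model of `C₁ = (QG₁Q\*)⁻¹` is n06-w5's `B9LettersZCFieldsAtPins.isTransposePair_C1coK`, consumed BY NAME) ★★ `isTransposePair_HcoK_H1Y` — `IsTransposePair (HcoK … (H1Y i parS parBY Gp Δ2) U₁) ((C1coK … ∘ₗ QcoKH …) ∘ₗ GcoK … (G1Y …) U₁)`
  ((3.129) at the pins, `HcoK_H1Y_eq`, + the three transposes); `isTransposePair_HcoK_H1Y_parSymY` (at `GpY parSymY`) and ★★ `isTransposePair_HcoK_H1Y_physY` (at
  PRINT's `G′_phys = GpPhysY parSymY` — the record's `H₁` letter, the N06 certificate's pin `hH1m12`): no hypothesis left but `G`-valuedness and the symmetry of the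
  residual `Δ⁽²⁾(U)` ([5]'s reality, the doors' displayed row ∕ the certificate's `hΔ2`).
* §2 ★★ `hH1T_of_G1_C1_lettersR` — AT THE PINS, class-parametric carrier `bg9YR (M_N(ℂ)) SU(N) R₁ R₂` (`MemOfFam SU(N) R₁`, `c` free), residual family `𝔯`: above ONE
  threshold and in the regime, the weighted transpose schema `hH1T` of `B9Eq3136HstarJAtPinsLetterFamily` §4 at the EXPLICIT family `𝔗 := (C₁ ∘ Q) ∘ G₁` from: Thm 3.12's
  `G₁` sup letter `hG1sup` (`HasMajorant (blkBK (bI x)) (GcoK … (G1Y … (GpPhysY …) (𝔯 x).Δ2) U) (r_G·e^{−(1−α)δ₀ d})`, DISPLAYED), the weighted (3.132) letter `hC1sup`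
  (`HasMajorant blkHK (C1coK … (GpPhysY …) (𝔯 x).Δ2 U) (r_C·W_C x a·e^{−δ₀ d})`, DISPLAYED; at the flat record `W_C = n_a`), the symmetry schema `hΔ2` of the residual
  (DISPLAYED, the certificate's binder shape), the 1-faithful pin `hβ1`, and n06-w5's `Q` letter + (2.61) member facts (theorems) — F10-R's proof VERBATIM with
  `isTransposePair_HcoK_HDY_parSymY ↦ isTransposePair_HcoK_H1Y_physY`.
* §3 ★★★ `etaDY_mul_norm_trAdjY_H1Y_JY_le_of_G1_C1_lettersR` — §2 ∘ `B9Eq3136HstarJAtPinsLetterFamily` §4: the doors' 𝒥-row input (b†)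
  `η^{d+1}·‖(H₁(U)†J(U))(c)‖ ≤ t_{HJ}·a·w₁` (uniform in `c`) from `hG1sup + hC1sup + hΔ2 + hreg` + the pins + the weight law for `W_C` + the constants — `hH1T` ELIMINATED;
  what stays displayed is Thm 3.12-species content of node N06 for `G₁` and `(QG₁Q\*)⁻¹` (the knit's class letters feed it through n06-w8's F11 `B9SupLettersFromClassLetters`)
  and r06's regularity datum `hreg` (a theorem at print's class, n06-w8 F12).
HONEST SCOPE.  Finite-dimensional transposition bookkeeping and [4] (2.51)∕(2.54)∕(2.55)∕(2.61) with explicit constants BY NAME (def-Y's dictionary, n06-d's models,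
n06-w5's `Q` letter, n06-w8's F7∕F9, p21∕n06-k member facts); the majorants of `G₁` (Thm 3.12) and of `C₁` ((3.132)) are HYPOTHESES of printed shape; nothing of [B9]
asserted; count-neutral; N06 ∕ N08 NOT discharged; one finite lattice at a time — nothing continuum ∕ ℝ⁴ ∕ OS ∕ mass gap ∕ Clay.  No `sorry`, no `def`, no `instance`,
no `notation`.  Cell `pub-ymgap` (HUMAN RULING D-0062), Track A nodes N06 [B9] ∕ N08 [B10], seat `pub-ymgap-dag-n08-d` (g42), 2026-08-29.
-/

noncomputable section

namespace Literature.MathematicalPhysics.QuantumFieldTheory.Balaban1983to89.B9Eq3129H1TransposeCoords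

open Node00 (CfgY FBondY IBondY SiteParY BondParY SiteOpY BondOpY parBY parSymY GpY GpPhysY QGQinvOfY_isSymmTr G1Y_isSymmTr_parSymY
  G1Y_GpPhysY_isSymmTr_parSymY H1Y G1Y QG1QinvY Stage3Params ResY etaDY etaBY trDualMatY trAdjY JY)
open Node00.OpsYSectDCoords (QcoKH QscoKH C1coK HcoK_H1Y_eq isTransposePair_QcoKH_QscoKH cR39_trBasis_pos)
open B6KLevelCensusIndexV1 (KIdx)
open B9Thm37Glue (IsTransposePair)
open B9Thm37GlueTorusCov (isTransposePair_smul)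
open B6RandomWalk (HasMajorant Triangle254 Ineq261)
open B6RandomWalkHom (HasMajorantHom)
open B9Thm34Ext (toB6)
open B9CoReadingCoords (XBK blkBK GcoK)
open B9CoReadingCoordsH (XHK blkHK HcoK)
open B9CoReadingCoordsTranspose (TrIdx trBasis trBasis_repr_eq_trace isTransposePair_coordOpK_of_isSymmTr isTransposePair_GcoK_trBasis)
open B9Thm311ReadingCoords (IsSymmTr)
open B9Thm39ReadingCoords (cR39 basisBound39)
open B9GeoNormsKLevelV1 (geo9K)
open B6Ineq2142KLevelV1 (β)
open B6GlobalChartV1 (PV blkV1)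
open B6Geom246MultiLevelTorus (geomT)
open B9Eq3126HTransposeCoords (hasMajorantHom_CQG_of_letters)
open B9LettersZCFieldsAtPins (isTransposePair_C1coK)
open B9RWSumsDefinitePins (PinPrims)
open B9RWSums347DefiniteFaces (exp261 lemma21Pack_geo9Y)
open B9RowSum261DefiniteFaces (rowConst261)
open B9PinMembersKLevelV1 (MemberY geo9Y bg9Y)
open B9GeoLemma21KLevelV1 (geo9Y_dist_triangle)
open B7Prop2SpecialUnitary (specialUnitaryUnits specialUnitaryUnits_le_unitaryUnits specialUnitaryUnits_le_U1)
open B9BackgroundsKLevelV1 (shiftsV1)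
open B9BackgroundsKLevelV1R (RegFamY bg9YR MemOfFam)
open B9Eq336CurrentBound (RegularAt)
open B9Eq3136HstarJAtPinsLetterFamily (etaDY_mul_norm_trAdjY_H1Y_JY_le_of_transpose_schemas_wR)
open scoped Matrix
open scoped Matrix.Norms.L2Operator

variable {N : ℕ} {d ℓ : ℕ} {hd : 1 ≤ d + 1} {hL : Odd (ℓ + 1) ∧ 1 < ℓ + 1} {b₀ b₁ : ℝ}
variable (i : KIdx d ℓ hd hL b₀ b₁) (B : B9.Backgrounds) (cfg : B.Cfg → CfgY (Matrix (Fin N) (Fin N) ℂ) i)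
  (parS : SiteParY (Matrix (Fin N) (Fin N) ℂ) i) (Gp : SiteOpY (Matrix (Fin N) (Fin N) ℂ) i) (Δ2 : BondOpY (Matrix (Fin N) (Fin N) ℂ) i)

/-! ## §1 The counting-transpose of the H₁-model is `(C₁ ∘ Q) ∘ G₁` -/

section Transpose

/-- ★★ **THE COUNTING-TRANSPOSE OF THE H₁-MODEL IS `(C₁ ∘ Q) ∘ G₁`** ((3.129) read backwards): at a `G`-valued configuration (`G ≤ U(N)`), taxicab transporters and a
trace-symmetric `G₁(U)`, `IsTransposePair (HcoK … (H1Y i parS parBY Gp Δ2) U₁) ((C1coK … ∘ₗ QcoKH …) ∘ₗ GcoK … (G1Y …) U₁)` — def-Y's `HcoK_H1Y_eq`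
(`HcoK(H₁) = GcoK(G₁) ∘ QscoKH ∘ C1coK`), the transposes of the three factors and `IsTransposePair.comp` (F9's `isTransposePair_HcoK_HDY` with `G_D ↦ G₁`, `C ↦ C₁`).
[cite: Balaban1985BackgroundPropagators, (3.129) p.421, p.393, Thm 3.11 p.416; Balaban1984PropagatorsII, (2.51) p.232] -/
theorem isTransposePair_HcoK_H1Y {G : Subgroup (Matrix (Fin N) (Fin N) ℂ)ˣ} (hG : G ≤ B7Prop2Explicit.unitaryUnits (Matrix (Fin N) (Fin N) ℂ))
    (hN : 0 < N) (U₁ : B.Cfg) (hU : ∀ μ x, cfg U₁ μ x ∈ G) (hG1 : IsSymmTr (fun _ => (1 : ℝ)) (G1Y i parS (parBY i) Gp Δ2 (cfg U₁))) :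
    IsTransposePair (HcoK i (trBasis N) B cfg (H1Y i parS (parBY i) Gp Δ2) U₁)
      ((C1coK i (trBasis N) B cfg parS (parBY i) Gp Δ2 U₁ ∘ₗ QcoKH i (trBasis N) B cfg (parBY i) U₁) ∘ₗ
        GcoK i (trBasis N) B cfg (G1Y i parS (parBY i) Gp Δ2) U₁) := by
  have hc : cR39 (trBasis N) ≠ 0 := (cR39_trBasis_pos hN).ne'
  rw [HcoK_H1Y_eq (i := i) (b := trBasis N) (B := B) (cfg := cfg) (parS := parS) (parB := parBY i) (Gp := Gp) (Δ2 := Δ2) hc U₁]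
  have hGt := isTransposePair_GcoK_trBasis i B cfg (G1Y i parS (parBY i) Gp Δ2) U₁ hG1
  have hQt : IsTransposePair (QscoKH i (trBasis N) B cfg (parBY i) U₁) (QcoKH i (trBasis N) B cfg (parBY i) U₁) :=
    (isTransposePair_QcoKH_QscoKH i B cfg U₁ hG hU).symm
  have hCt := isTransposePair_C1coK i B cfg parS Gp Δ2 hG U₁ hU hG1
  exact (hCt.comp hQt).comp hGt

/-- ★★ at def-Y's symmetrised transporters `parSymY` and the LATTICE site propagator `GpY parSymY`: no hypothesis left but `G`-valuedness and the symmetry of the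
residual `Δ⁽²⁾(U)` (def-Y's `G1Y_isSymmTr_parSymY`). [cite: Balaban1985BackgroundPropagators, (3.129) p.421, Thm 3.11 p.416] -/
theorem isTransposePair_HcoK_H1Y_parSymY {G : Subgroup (Matrix (Fin N) (Fin N) ℂ)ˣ} (hG : G ≤ B7Prop2Explicit.unitaryUnits (Matrix (Fin N) (Fin N) ℂ))
    (hN : 0 < N) (U₁ : B.Cfg) (hU : ∀ μ x, cfg U₁ μ x ∈ G) (hΔ2 : IsSymmTr (fun _ => (1 : ℝ)) (Δ2 (cfg U₁))) :
    IsTransposePair (HcoK i (trBasis N) B cfg (H1Y i (parSymY i) (parBY i) (GpY i (parSymY i)) Δ2) U₁)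
      ((C1coK i (trBasis N) B cfg (parSymY i) (parBY i) (GpY i (parSymY i)) Δ2 U₁ ∘ₗ QcoKH i (trBasis N) B cfg (parBY i) U₁) ∘ₗ
        GcoK i (trBasis N) B cfg (G1Y i (parSymY i) (parBY i) (GpY i (parSymY i)) Δ2) U₁) :=
  isTransposePair_HcoK_H1Y i B cfg (parSymY i) (GpY i (parSymY i)) Δ2 hG hN U₁ hU (G1Y_isSymmTr_parSymY i hG hU Δ2 hΔ2)

/-- ★★ **AT PRINT's `G′_phys = GpPhysY parSymY`** — the record's own `H₁` letter `(lettersYOfRecordV4P …).H₁ U = H1Y … (GpPhysY …) (𝔯 x).Δ2 U` (the N06 certificate's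
pin `hH1m12`, the (3.24) doors' 𝒥-row object): no hypothesis left but `G`-valuedness and the symmetry of `Δ⁽²⁾(U)` (def-Y's `G1Y_GpPhysY_isSymmTr_parSymY`).
[cite: Balaban1985BackgroundPropagators, (3.129) p.421, (3.24)–(3.25) p.394, Thm 3.11 p.416] -/
theorem isTransposePair_HcoK_H1Y_physY {G : Subgroup (Matrix (Fin N) (Fin N) ℂ)ˣ} (hG : G ≤ B7Prop2Explicit.unitaryUnits (Matrix (Fin N) (Fin N) ℂ))
    (hN : 0 < N) (U₁ : B.Cfg) (hU : ∀ μ x, cfg U₁ μ x ∈ G) (hΔ2 : IsSymmTr (fun _ => (1 : ℝ)) (Δ2 (cfg U₁))) :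
    IsTransposePair (HcoK i (trBasis N) B cfg (H1Y i (parSymY i) (parBY i) (GpPhysY i (parSymY i)) Δ2) U₁)
      ((C1coK i (trBasis N) B cfg (parSymY i) (parBY i) (GpPhysY i (parSymY i)) Δ2 U₁ ∘ₗ QcoKH i (trBasis N) B cfg (parBY i) U₁) ∘ₗ
        GcoK i (trBasis N) B cfg (G1Y i (parSymY i) (parBY i) (GpPhysY i (parSymY i)) Δ2) U₁) :=
  isTransposePair_HcoK_H1Y i B cfg (parSymY i) (GpPhysY i (parSymY i)) Δ2 hG hN U₁ hU (G1Y_GpPhysY_isSymmTr_parSymY i hG hU Δ2 hΔ2)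

end Transpose

/-! ## §2 At the pins: the weighted transpose schema `hH1T` of the doors from Thm 3.12's `G₁` sup letter and the weighted (3.132) letter for `C₁` -/

section AtPins

variable {θ : Stage3Params} {Mstar : ℕ} [NeZero N]
variable [∀ x : MemberY θ.d₆ θ.ℓ₆ θ.hd' θ.hL' θ.b₀ θ.b₁ Mstar, Fintype (geo9Y x).Site]

/-- ★★ **THE WEIGHTED TRANSPOSE SCHEMA `hH1T` OF `B9Eq3136HstarJAtPinsLetterFamily` §4 AT THE EXPLICIT FAMILY `𝔗 := (C₁ ∘ Q) ∘ G₁`, FROM THE `G₁` AND WEIGHTED-`C₁`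
SUP LETTERS** (the `H₁` twin of n06-w8's `…N06HTransposeAtPinsPhysR.hHT_of_GD_C_lettersR`, proof VERBATIM with the §1 transpose identity): class-parametric carrier
`bg9YR (M_N(ℂ)) SU(N) R₁ R₂` (`MemOfFam SU(N) R₁`, `c` free), residual family `𝔯`, above ONE threshold and in the regime: (i) `IsTransposePair (HcoK … (H1Y … (GpPhysY …)
(𝔯 x).Δ2) U) ((C1coK … U ∘ₗ QcoKH … U) ∘ₗ GcoK … (G1Y … (GpPhysY …) (𝔯 x).Δ2) U)` (a THEOREM at `SU(N)`-valued `U` and symmetric `Δ⁽²⁾(U)` — the displayed schema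
`hΔ2`, the certificate's binder shape) and (ii) its [4]-(2.51) majorant `r_C·c₁·W_C(c)·(e^{δ₀(ℓ+4)}·c₁·1·r_G)·e^{−(1−α)δ₀ d(c,y′)}` from the fine carrier (blocks `bI x`) to
the coarse one, from `hG1sup` (Thm 3.12's `G₁` sup majorant, DISPLAYED) and `hC1sup` (the weighted (3.132) letter for `(QG₁Q\*)⁻¹`, DISPLAYED) by F9 §2
`hasMajorantHom_CQG_of_letters` (n06-w5's `Q` letter and (2.61) at `(δ₀, α)` inside).
[cite: Balaban1985BackgroundPropagators, (3.129) p.421, (3.132)–(3.133) p.422, Thm 3.12 p.423, (3.12)–(3.14) p.393, Thm 3.11 p.416; Balaban1984PropagatorsII, (2.51)–(2.56) pp.232–233, Lemma 2.1 (2.61) p.234] -/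
theorem hH1T_of_G1_C1_lettersR (q : PinPrims) (hq : q.OK) (H : MemberY θ.d₆ θ.ℓ₆ θ.hd' θ.hL' θ.b₀ θ.b₁ Mstar → Prop)
    (R₁ R₂ : RegFamY θ.d₆ θ.ℓ₆ θ.hd' θ.hL' θ.b₀ θ.b₁ Mstar (Matrix (Fin N) (Fin N) ℂ)) (hG : MemOfFam (specialUnitaryUnits (Fin N)) R₁) (c : ℝ)
    (𝔯 : ResY N θ Mstar)
    (hΔ2 : ∀ (x : MemberY θ.d₆ θ.ℓ₆ θ.hd' θ.hL' θ.b₀ θ.b₁ Mstar) (U : (bg9Y (Matrix (Fin N) (Fin N) ℂ) (specialUnitaryUnits (Fin N)) x).Cfg),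
      (∀ μ z, U μ z ∈ specialUnitaryUnits (Fin N)) → IsSymmTr (fun _ => (1 : ℝ)) ((𝔯 x).Δ2 U))
    (bI : ∀ x : MemberY θ.d₆ θ.ℓ₆ θ.hd' θ.hL' θ.b₀ θ.b₁ Mstar, FBondY x.toKIdx → IBondY x.toKIdx)
    (hβ1 : ∀ (x : MemberY θ.d₆ θ.ℓ₆ θ.hd' θ.hL' θ.b₀ θ.b₁ Mstar) (f : FBondY x.toKIdx), (geomT x.D).dist (β x.hN x.D x.hk (bI x f)) (blkV1 x.hN x.D f) ≤ 1)
    (WC : ∀ x : MemberY θ.d₆ θ.ℓ₆ θ.hd' θ.hL' θ.b₀ θ.b₁ Mstar, IBondY x.toKIdx → ℝ) (hWC : ∀ x c, 0 ≤ WC x c)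
    (rG rC M a : ℝ) (hrG : 0 ≤ rG) (hrC : 0 ≤ rC)
    (hG1sup : ∀ x : MemberY θ.d₆ θ.ℓ₆ θ.hd' θ.hL' θ.b₀ θ.b₁ Mstar, M ≤ (geo9Y x).M → ∀ α₀ : ℝ, 0 < α₀ → (geo9Y x).M * α₀ ≤ a →
      ∀ U : (bg9Y (Matrix (Fin N) (Fin N) ℂ) (specialUnitaryUnits (Fin N)) x).Cfg,
        (bg9YR (Matrix (Fin N) (Fin N) ℂ) (specialUnitaryUnits (Fin N)) R₁ R₂ x).Reg335 c α₀ U →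
        (bg9YR (Matrix (Fin N) (Fin N) ℂ) (specialUnitaryUnits (Fin N)) R₁ R₂ x).Reg336 c α₀ U →
          HasMajorant (g := toB6 (geo9Y x) 1 (H x)) (blkBK x.toKIdx (bI x))
            (GcoK x.toKIdx (trBasis N) (bg9Y (Matrix (Fin N) (Fin N) ℂ) (specialUnitaryUnits (Fin N)) x) (fun U => U)
              (G1Y x.toKIdx (parSymY x.toKIdx) (parBY x.toKIdx) (GpPhysY x.toKIdx (parSymY x.toKIdx)) (𝔯 x).Δ2) U)
            (fun a b => rG * Real.exp (-((1 - q.α) * q.δ₀ * (geo9Y x).dist a b))))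
    (hC1sup : ∀ x : MemberY θ.d₆ θ.ℓ₆ θ.hd' θ.hL' θ.b₀ θ.b₁ Mstar, M ≤ (geo9Y x).M → ∀ α₀ : ℝ, 0 < α₀ → (geo9Y x).M * α₀ ≤ a →
      ∀ U : (bg9Y (Matrix (Fin N) (Fin N) ℂ) (specialUnitaryUnits (Fin N)) x).Cfg,
        (bg9YR (Matrix (Fin N) (Fin N) ℂ) (specialUnitaryUnits (Fin N)) R₁ R₂ x).Reg335 c α₀ U →
        (bg9YR (Matrix (Fin N) (Fin N) ℂ) (specialUnitaryUnits (Fin N)) R₁ R₂ x).Reg336 c α₀ U →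
          HasMajorant (g := toB6 (geo9Y x) 1 (H x)) (blkHK x.toKIdx)
            (C1coK x.toKIdx (trBasis N) (bg9Y (Matrix (Fin N) (Fin N) ℂ) (specialUnitaryUnits (Fin N)) x) (fun U => U)
              (parSymY x.toKIdx) (parBY x.toKIdx) (GpPhysY x.toKIdx (parSymY x.toKIdx)) (𝔯 x).Δ2 U)
            (fun a b => rC * WC x a * Real.exp (-(q.δ₀ * (geo9Y x).dist a b)))) :
    ∃ MT : ℝ, ∀ x : MemberY θ.d₆ θ.ℓ₆ θ.hd' θ.hL' θ.b₀ θ.b₁ Mstar, MT ≤ (geo9Y x).M → M ≤ (geo9Y x).M → ∀ α₀ : ℝ, 0 < α₀ → (geo9Y x).M * α₀ ≤ a →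
      ∀ U : (bg9Y (Matrix (Fin N) (Fin N) ℂ) (specialUnitaryUnits (Fin N)) x).Cfg,
        (bg9YR (Matrix (Fin N) (Fin N) ℂ) (specialUnitaryUnits (Fin N)) R₁ R₂ x).Reg335 c α₀ U →
        (bg9YR (Matrix (Fin N) (Fin N) ℂ) (specialUnitaryUnits (Fin N)) R₁ R₂ x).Reg336 c α₀ U →
          IsTransposePair (HcoK x.toKIdx (trBasis N) (bg9Y (Matrix (Fin N) (Fin N) ℂ) (specialUnitaryUnits (Fin N)) x) (fun U => U)
              (H1Y x.toKIdx (parSymY x.toKIdx) (parBY x.toKIdx) (GpPhysY x.toKIdx (parSymY x.toKIdx)) (𝔯 x).Δ2) U)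
            ((C1coK x.toKIdx (trBasis N) (bg9Y (Matrix (Fin N) (Fin N) ℂ) (specialUnitaryUnits (Fin N)) x) (fun U => U)
                (parSymY x.toKIdx) (parBY x.toKIdx) (GpPhysY x.toKIdx (parSymY x.toKIdx)) (𝔯 x).Δ2 U ∘ₗ
              QcoKH x.toKIdx (trBasis N) (bg9Y (Matrix (Fin N) (Fin N) ℂ) (specialUnitaryUnits (Fin N)) x) (fun U => U) (parBY x.toKIdx) U) ∘ₗ
              GcoK x.toKIdx (trBasis N) (bg9Y (Matrix (Fin N) (Fin N) ℂ) (specialUnitaryUnits (Fin N)) x) (fun U => U)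
                (G1Y x.toKIdx (parSymY x.toKIdx) (parBY x.toKIdx) (GpPhysY x.toKIdx (parSymY x.toKIdx)) (𝔯 x).Δ2) U) ∧
            HasMajorantHom (g := toB6 (geo9Y x) 1 (H x)) (fun p : XBK (TrIdx N) x.toKIdx => bI x p.1) (fun p : XHK (TrIdx N) x.toKIdx => p.1)
              ((C1coK x.toKIdx (trBasis N) (bg9Y (Matrix (Fin N) (Fin N) ℂ) (specialUnitaryUnits (Fin N)) x) (fun U => U)
                  (parSymY x.toKIdx) (parBY x.toKIdx) (GpPhysY x.toKIdx (parSymY x.toKIdx)) (𝔯 x).Δ2 U ∘ₗ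
                QcoKH x.toKIdx (trBasis N) (bg9Y (Matrix (Fin N) (Fin N) ℂ) (specialUnitaryUnits (Fin N)) x) (fun U => U) (parBY x.toKIdx) U) ∘ₗ
                GcoK x.toKIdx (trBasis N) (bg9Y (Matrix (Fin N) (Fin N) ℂ) (specialUnitaryUnits (Fin N)) x) (fun U => U)
                  (G1Y x.toKIdx (parSymY x.toKIdx) (parBY x.toKIdx) (GpPhysY x.toKIdx (parSymY x.toKIdx)) (𝔯 x).Δ2) U)
              (fun c y' => (rC * B6.c1 (exp261 (@geo9Y θ.d₆ θ.ℓ₆ θ.hd' θ.hL' θ.b₀ θ.b₁ Mstar) q.δ₀ q.α) q.δ₀ q.α *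
                  (Real.exp (q.δ₀ * ((θ.ℓ₆ : ℝ) + 4)) * B6.c1 (exp261 (@geo9Y θ.d₆ θ.ℓ₆ θ.hd' θ.hL' θ.b₀ θ.b₁ Mstar) q.δ₀ q.α) q.δ₀ q.α * 1 * rG)) *
                WC x c * Real.exp (-((1 - q.α) * q.δ₀ * (geo9Y x).dist c y'))) := by
  obtain ⟨Mth, h261, -, -⟩ :=
    lemma21Pack_geo9Y (d := θ.d₆) (ℓ := θ.ℓ₆) (hd := θ.hd') (hL := θ.hL') (b₀ := θ.b₀) (b₁ := θ.b₁) (Mstar := Mstar) H hq.α_pos hq.α_lt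
      hq.δ₀_pos hq.αF_pos (by linarith only [hq.αF_lt])
  have hN : 0 < N := Nat.pos_of_ne_zero (NeZero.ne N)
  refine ⟨Mth, fun x hMx hMM α₀ hα ha U hU hU' => ?_⟩
  have hGv : ∀ μ z, U μ z ∈ specialUnitaryUnits (Fin N) := hG x c α₀ U hU
  refine ⟨isTransposePair_HcoK_H1Y_physY x.toKIdx (bg9Y (Matrix (Fin N) (Fin N) ℂ) (specialUnitaryUnits (Fin N)) x) (fun U => U) (𝔯 x).Δ2
    specialUnitaryUnits_le_unitaryUnits hN U hGv (hΔ2 x U hGv), ?_⟩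
  letI : Fintype (geo9K x.toKIdx).Site := (inferInstance : Fintype (geo9Y x).Site)
  have htri : B6RandomWalk.Triangle254 (toB6 (geo9K x.toKIdx) 1 (H x)) := fun a b c => geo9Y_dist_triangle x a b c
  have hαδ : 0 ≤ (1 - q.α) * q.δ₀ := mul_nonneg (by linarith only [hq.α_lt]) hq.δ₀_pos.le
  have h := hasMajorantHom_CQG_of_letters (R₀ := 1) (H₀ := H x) x.toKIdx (bg9Y (Matrix (Fin N) (Fin N) ℂ) (specialUnitaryUnits (Fin N)) x) (fun U => U)
    (hβ1 x) U (fun s s' => specialUnitaryUnits_le_U1 (Node00.parBY_mem x.toKIdx (G := specialUnitaryUnits (Fin N)) hGv s s')) htri hq.δ₀_pos.le hαδ hrG hrC (hWC x)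
    (h261 x hMx) (hG1sup x hMM α₀ hα ha U hU hU') (hC1sup x hMM α₀ hα ha U hU hU')
  refine B6RandomWalkHom.hasMajorantHom_mono _ _ h fun a b => le_of_eq ?_
  have hd : (geo9Y x).dist a b = (geo9K x.toKIdx).dist a b := rfl
  rw [hd]
  ring

/-! ## §3 The doors' 𝒥-row input (b†) from `hG1sup + hC1sup + hΔ2 + hreg` — the transpose schema ELIMINATED -/

/-- ★★★ **THE (3.24) DOORS' 𝒥-ROW INPUT (b†) FROM THM 3.12's `G₁` SUP LETTER AND THE WEIGHTED (3.132) LETTER FOR `(QG₁Q\*)⁻¹`** (§2 ∘ `B9Eq3136HstarJAtPinsLetterFamily` §4):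
class-parametric carrier (`MemOfFam SU(N) R₁`, `c` free), residual family `𝔯`; above ONE threshold and in the regime, for EVERY coarse bond `c`,
`η^{d+1}·‖(H₁(U)†J(U))(c)‖ ≤ t_{HJ}·a·w₁` from: `hG1sup`, `hC1sup` (DISPLAYED, node N06's Thm 3.12 ∕ (3.132) species), the symmetry schema `hΔ2` of `Δ⁽²⁾(U)` ([5]'s
reality; the certificate's binder), r06's regularity datum at every fine bond `hreg` (DISPLAYED here; a theorem at print's class), the pins `hbI0 ∕ hβ1`, the weight law
`η^{d+1}·(W_C(c)·((Lʲη)_c³)⁻¹) ≤ w₁`, the rate budget `α_F(1−2α)δ₀ + ρ_R ≤ (1−α)δ₀` and ONE constant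
`t_{HJ} ≥ N𝔟²·(10⁴(d+1)c_J)·((d+1)·#κ·B_T)·(ℓ+1)³·rowConst261 geo9Y ρ_R` with `B_T := r_C·c₁·(e^{δ₀(ℓ+4)}·c₁·1·r_G)` the explicit transpose constant.
[cite: Balaban1985BackgroundPropagators, p.422 (the sentence between (3.136) and (3.137)), (3.129) p.421, (3.132)–(3.133) p.422, Thm 3.12 p.423, (3.36) p.396, (3.13) p.392, (3.156) p.428; Balaban1984PropagatorsII, (2.51)–(2.56) pp.232–233, Lemma 2.1 (2.60)–(2.61) pp.233–234] -/
theorem etaDY_mul_norm_trAdjY_H1Y_JY_le_of_G1_C1_lettersR (q : PinPrims) (hq : q.OK) (H : MemberY θ.d₆ θ.ℓ₆ θ.hd' θ.hL' θ.b₀ θ.b₁ Mstar → Prop)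
    (R₁ R₂ : RegFamY θ.d₆ θ.ℓ₆ θ.hd' θ.hL' θ.b₀ θ.b₁ Mstar (Matrix (Fin N) (Fin N) ℂ)) (hG : MemOfFam (specialUnitaryUnits (Fin N)) R₁) (c : ℝ)
    (𝔯 : ResY N θ Mstar)
    (hΔ2 : ∀ (x : MemberY θ.d₆ θ.ℓ₆ θ.hd' θ.hL' θ.b₀ θ.b₁ Mstar) (U : (bg9Y (Matrix (Fin N) (Fin N) ℂ) (specialUnitaryUnits (Fin N)) x).Cfg),
      (∀ μ z, U μ z ∈ specialUnitaryUnits (Fin N)) → IsSymmTr (fun _ => (1 : ℝ)) ((𝔯 x).Δ2 U))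
    (bI : ∀ x : MemberY θ.d₆ θ.ℓ₆ θ.hd' θ.hL' θ.b₀ θ.b₁ Mstar, FBondY x.toKIdx → IBondY x.toKIdx)
    (hbI0 : ∀ (x : MemberY θ.d₆ θ.ℓ₆ θ.hd' θ.hL' θ.b₀ θ.b₁ Mstar) (f : FBondY x.toKIdx), bI x f = bI x ⟨f.src, 0⟩)
    (hβ1 : ∀ (x : MemberY θ.d₆ θ.ℓ₆ θ.hd' θ.hL' θ.b₀ θ.b₁ Mstar) (f : FBondY x.toKIdx), (geomT x.D).dist (β x.hN x.D x.hk (bI x f)) (blkV1 x.hN x.D f) ≤ 1)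
    (WC : ∀ x : MemberY θ.d₆ θ.ℓ₆ θ.hd' θ.hL' θ.b₀ θ.b₁ Mstar, IBondY x.toKIdx → ℝ) (hWC : ∀ x c, 0 ≤ WC x c)
    {w₁ : ℝ} (hWη : ∀ (x : MemberY θ.d₆ θ.ℓ₆ θ.hd' θ.hL' θ.b₀ θ.b₁ Mstar) (c : IBondY x.toKIdx), etaDY x * (WC x c * ((geo9Y x).len c ^ 3)⁻¹) ≤ w₁)
    (rG rC cJ ρR tHJ M a : ℝ) (hrG : 0 ≤ rG) (hrC : 0 ≤ rC) (hcJ : 0 ≤ cJ) (hρR : 0 < ρR) (hM : 0 < M) (ha1 : cJ * a ≤ 1)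
    (hρ : q.αF * ((1 - 2 * q.α) * q.δ₀) + ρR ≤ (1 - q.α) * q.δ₀)
    (htHJ : N * basisBound39 (trBasis N) ^ 2 * (10 ^ 4 * ((θ.d₆ : ℝ) + 1) * cJ) *
      (((θ.d₆ : ℝ) + 1) * Fintype.card (TrIdx N) *
        (rC * B6.c1 (exp261 (@geo9Y θ.d₆ θ.ℓ₆ θ.hd' θ.hL' θ.b₀ θ.b₁ Mstar) q.δ₀ q.α) q.δ₀ q.α *
          (Real.exp (q.δ₀ * ((θ.ℓ₆ : ℝ) + 4)) * B6.c1 (exp261 (@geo9Y θ.d₆ θ.ℓ₆ θ.hd' θ.hL' θ.b₀ θ.b₁ Mstar) q.δ₀ q.α) q.δ₀ q.α * 1 * rG))) *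
      ((((θ.ℓ₆ + 1 : ℕ) : ℝ) ^ 3) * rowConst261 (geo9Y (d := θ.d₆) (ℓ := θ.ℓ₆) (hd := θ.hd') (hL := θ.hL') (b₀ := θ.b₀) (b₁ := θ.b₁) (Mstar := Mstar)) ρR) ≤ tHJ)
    (hG1sup : ∀ x : MemberY θ.d₆ θ.ℓ₆ θ.hd' θ.hL' θ.b₀ θ.b₁ Mstar, M ≤ (geo9Y x).M → ∀ α₀ : ℝ, 0 < α₀ → (geo9Y x).M * α₀ ≤ a →
      ∀ U : (bg9Y (Matrix (Fin N) (Fin N) ℂ) (specialUnitaryUnits (Fin N)) x).Cfg,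
        (bg9YR (Matrix (Fin N) (Fin N) ℂ) (specialUnitaryUnits (Fin N)) R₁ R₂ x).Reg335 c α₀ U →
        (bg9YR (Matrix (Fin N) (Fin N) ℂ) (specialUnitaryUnits (Fin N)) R₁ R₂ x).Reg336 c α₀ U →
          HasMajorant (g := toB6 (geo9Y x) 1 (H x)) (blkBK x.toKIdx (bI x))
            (GcoK x.toKIdx (trBasis N) (bg9Y (Matrix (Fin N) (Fin N) ℂ) (specialUnitaryUnits (Fin N)) x) (fun U => U)
              (G1Y x.toKIdx (parSymY x.toKIdx) (parBY x.toKIdx) (GpPhysY x.toKIdx (parSymY x.toKIdx)) (𝔯 x).Δ2) U)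
            (fun a b => rG * Real.exp (-((1 - q.α) * q.δ₀ * (geo9Y x).dist a b))))
    (hC1sup : ∀ x : MemberY θ.d₆ θ.ℓ₆ θ.hd' θ.hL' θ.b₀ θ.b₁ Mstar, M ≤ (geo9Y x).M → ∀ α₀ : ℝ, 0 < α₀ → (geo9Y x).M * α₀ ≤ a →
      ∀ U : (bg9Y (Matrix (Fin N) (Fin N) ℂ) (specialUnitaryUnits (Fin N)) x).Cfg,
        (bg9YR (Matrix (Fin N) (Fin N) ℂ) (specialUnitaryUnits (Fin N)) R₁ R₂ x).Reg335 c α₀ U →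
        (bg9YR (Matrix (Fin N) (Fin N) ℂ) (specialUnitaryUnits (Fin N)) R₁ R₂ x).Reg336 c α₀ U →
          HasMajorant (g := toB6 (geo9Y x) 1 (H x)) (blkHK x.toKIdx)
            (C1coK x.toKIdx (trBasis N) (bg9Y (Matrix (Fin N) (Fin N) ℂ) (specialUnitaryUnits (Fin N)) x) (fun U => U)
              (parSymY x.toKIdx) (parBY x.toKIdx) (GpPhysY x.toKIdx (parSymY x.toKIdx)) (𝔯 x).Δ2 U)
            (fun a b => rC * WC x a * Real.exp (-(q.δ₀ * (geo9Y x).dist a b))))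
    (hreg : ∀ x : MemberY θ.d₆ θ.ℓ₆ θ.hd' θ.hL' θ.b₀ θ.b₁ Mstar, M ≤ (geo9Y x).M → ∀ α₀ : ℝ, 0 < α₀ → (geo9Y x).M * α₀ ≤ a →
      ∀ U : (bg9Y (Matrix (Fin N) (Fin N) ℂ) (specialUnitaryUnits (Fin N)) x).Cfg,
        (bg9YR (Matrix (Fin N) (Fin N) ℂ) (specialUnitaryUnits (Fin N)) R₁ R₂ x).Reg335 c α₀ U →
        (bg9YR (Matrix (Fin N) (Fin N) ℂ) (specialUnitaryUnits (Fin N)) R₁ R₂ x).Reg336 c α₀ U →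
          ∀ μ s, RegularAt (shiftsV1 (PV θ.d₆ θ.ℓ₆ x.toKIdx.m x.toKIdx.K θ.hd' θ.hL')) U (etaBY x.toKIdx)
            (cJ * ((geo9Y x).M * α₀)) ((geo9Y x).len (bI x ⟨s, 0⟩)) μ s) :
    ∃ MH : ℝ, ∀ x : MemberY θ.d₆ θ.ℓ₆ θ.hd' θ.hL' θ.b₀ θ.b₁ Mstar, MH ≤ (geo9Y x).M → M ≤ (geo9Y x).M → ∀ α₀ : ℝ, 0 < α₀ → (geo9Y x).M * α₀ ≤ a →
      ∀ U : (bg9Y (Matrix (Fin N) (Fin N) ℂ) (specialUnitaryUnits (Fin N)) x).Cfg,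
        (bg9YR (Matrix (Fin N) (Fin N) ℂ) (specialUnitaryUnits (Fin N)) R₁ R₂ x).Reg335 c α₀ U →
        (bg9YR (Matrix (Fin N) (Fin N) ℂ) (specialUnitaryUnits (Fin N)) R₁ R₂ x).Reg336 c α₀ U →
          ∀ c : IBondY x.toKIdx,
            etaDY x * ‖trAdjY (trDualMatY N) (H1Y x.toKIdx (parSymY x.toKIdx) (parBY x.toKIdx) (GpPhysY x.toKIdx (parSymY x.toKIdx)) (𝔯 x).Δ2 U)
              (JY x.toKIdx U) c‖ ≤ tHJ * a * w₁ := by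
  obtain ⟨MT, hT⟩ := hH1T_of_G1_C1_lettersR q hq H R₁ R₂ hG c 𝔯 hΔ2 bI hβ1 WC hWC rG rC M a hrG hrC hG1sup hC1sup
  have hBT : 0 ≤ rC * B6.c1 (exp261 (@geo9Y θ.d₆ θ.ℓ₆ θ.hd' θ.hL' θ.b₀ θ.b₁ Mstar) q.δ₀ q.α) q.δ₀ q.α *
      (Real.exp (q.δ₀ * ((θ.ℓ₆ : ℝ) + 4)) * B6.c1 (exp261 (@geo9Y θ.d₆ θ.ℓ₆ θ.hd' θ.hL' θ.b₀ θ.b₁ Mstar) q.δ₀ q.α) q.δ₀ q.α * 1 * rG) := by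
    have h := B6RandomWalk.c1_nonneg (exp261 (@geo9Y θ.d₆ θ.ℓ₆ θ.hd' θ.hL' θ.b₀ θ.b₁ Mstar) q.δ₀ q.α) q.δ₀ q.α
    have _ := hq.δ₀_pos
    positivity
  have hMmax : 0 < max M MT := lt_max_of_lt_left hM
  obtain ⟨MH, hMH⟩ := etaDY_mul_norm_trAdjY_H1Y_JY_le_of_transpose_schemas_wR (N := N) q hq H R₁ R₂ c 𝔯 bI hbI0
    (fun x U => (C1coK x.toKIdx (trBasis N) (bg9Y (Matrix (Fin N) (Fin N) ℂ) (specialUnitaryUnits (Fin N)) x) (fun U => U)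
        (parSymY x.toKIdx) (parBY x.toKIdx) (GpPhysY x.toKIdx (parSymY x.toKIdx)) (𝔯 x).Δ2 U ∘ₗ
      QcoKH x.toKIdx (trBasis N) (bg9Y (Matrix (Fin N) (Fin N) ℂ) (specialUnitaryUnits (Fin N)) x) (fun U => U) (parBY x.toKIdx) U) ∘ₗ
      GcoK x.toKIdx (trBasis N) (bg9Y (Matrix (Fin N) (Fin N) ℂ) (specialUnitaryUnits (Fin N)) x) (fun U => U)
        (G1Y x.toKIdx (parSymY x.toKIdx) (parBY x.toKIdx) (GpPhysY x.toKIdx (parSymY x.toKIdx)) (𝔯 x).Δ2) U)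
    WC hWC hWη cJ _ ((1 - q.α) * q.δ₀) ρR tHJ (max M MT) a hcJ hBT hρR hMmax ha1 hρ htHJ
    (fun x hMx α₀ hα ha U hU hU' => hT x ((le_max_right _ _).trans hMx) ((le_max_left _ _).trans hMx) α₀ hα ha U hU hU')
    (fun x hMx α₀ hα ha U hU hU' => hreg x ((le_max_left _ _).trans hMx) α₀ hα ha U hU hU')
  exact ⟨max MH MT, fun x hMx hMM α₀ hα ha U hU hU' c =>
    hMH x ((le_max_left _ _).trans hMx) (max_le hMM ((le_max_right _ _).trans hMx)) α₀ hα ha U hU hU' c⟩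

end AtPins

end Literature.MathematicalPhysics.QuantumFieldTheory.Balaban1983to89.B9Eq3129H1TransposeCoords

end
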